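import Summits.Ventures.HodgeRepro.CMHodgeSpanOn
import Summits.Ventures.HodgeRepro.Night3GSetForm

/-!
# The Hodge type of the `(1,1)`-classes and of Weil's class `Λ`

Blind re-derivation cell `pub-hodge-repro`, seat `night-3` (gen 5, row 6; NIGHT3.md §11.9).  Imports typer-2's
`CMHodgeSpanOn` (the cocharacters `cocharOn`, the joint eigenspaces `jointEigenspaceOn Ψ (2p) p` = the classes of
type `(p, p)` for a family `Ψ` of cocharacters, `prodTypeSet`) and this gen's `Night3GSetForm` (the monomials `ωc`,
the classes `Lclass`, `Λc`).  Namespace `HodgeRepro.Night3.GSetModel`.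

* `IsEigen Ψ p x` — «every cocharacter `⋀^• μ_{Ψ γ}(λ)` multiplies `x` by `λ^p`», on the whole exterior algebra
  (no degree bookkeeping); stable under sums, scalars and PRODUCTS (the exponents add: `⋀^• μ` is an algebra map);
* `coe_exteriorPower_map` / `mem_jointEigenspaceOn_of_isEigen`: for `x ∈ ⋀^d`, `IsEigen Ψ p x` is exactly membership
  in typer-2's `jointEigenspaceOn Ψ d p`;
* `isEigen_ωc`: for the Galois-conjugate product types `Ψ g = prodTypeSet (i ↦ g • T i)` of a family `T` of CM types,
  every monomial `e_{(i,ρ)} ∧ e_{(i,cρ)}` is of type `(1, 1)` (exactly one of `ρ, cρ` lies in the CM type `g • T i`);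
* **`Lclass_mem_jointEigenspaceOn`**: the `(1,1)`-classes of the factors ARE `(1,1)`-classes;
* **`Λc_mem_jointEigenspaceOn`**: Weil's class `Λ = ∏_i L_i^{m−1}` is a Hodge class of type `((m−1)n, (m−1)n)`
  for every Galois-conjugate cocharacter of the product.

READING: the Hodge-theoretic half of «`Λ` is algebraic» (Deligne LNM 900 §3 / Ex. 3.7 for the cocharacters); the
rationality of the `L_i` and Lefschetz (1,1) are on the route's side, not modelled.  Nothing here closes S4; nothing
here says anything about the status of the Hodge conjecture for CM abelian varieties, which is NOT proved.
-/

set_option autoImplicit false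
open Finset Module
open scoped Pointwise IsMulCommutative
namespace HodgeRepro.Night3.GSetModel

open HodgeRepro.CMHodgeOn ExteriorAlgebra

/-! ### The eigen predicate on the exterior algebra and its closure properties -/

section Eigen

variable {X : Type*} [DecidableEq X] {Γ : Type*}

/-- «Every cocharacter `⋀^• μ_{Ψ γ}(λ)` multiplies `x` by `λ^p`» — the `(p, p)`-condition on the exterior algebra. -/
def IsEigen (Ψ : Γ → Finset X) (p : ℕ) (x : ExteriorAlgebra ℂ (X → ℂ)) : Prop :=
  ∀ (γ : Γ) (lam : ℂ), ExteriorAlgebra.map (cocharOn (Ψ γ) lam) x = lam ^ p • x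

variable {Ψ : Γ → Finset X}

/-- `1` is of type `(0, 0)`. -/
theorem IsEigen.one : IsEigen Ψ 0 (1 : ExteriorAlgebra ℂ (X → ℂ)) := fun _ _ => by
  rw [map_one, pow_zero, one_smul]

/-- `0` is of every type. -/
theorem IsEigen.zero (p : ℕ) : IsEigen Ψ p (0 : ExteriorAlgebra ℂ (X → ℂ)) := fun _ _ => by
  rw [map_zero, smul_zero]

/-- Sums of `(p, p)`-classes are `(p, p)`-classes. -/
theorem IsEigen.add {p : ℕ} {x y : ExteriorAlgebra ℂ (X → ℂ)} (hx : IsEigen Ψ p x) (hy : IsEigen Ψ p y) :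
    IsEigen Ψ p (x + y) := fun γ lam => by
  rw [map_add, hx γ lam, hy γ lam, smul_add]

/-- Scalar multiples of `(p, p)`-classes are `(p, p)`-classes. -/
theorem IsEigen.smul {p : ℕ} {x : ExteriorAlgebra ℂ (X → ℂ)} (hx : IsEigen Ψ p x) (r : ℂ) :
    IsEigen Ψ p (r • x) := fun γ lam => by
  rw [map_smul, hx γ lam, smul_comm]

/-- **Products**: a `(p, p)`-class times a `(q, q)`-class is a `(p + q, p + q)`-class. -/
theorem IsEigen.mul {p q : ℕ} {x y : ExteriorAlgebra ℂ (X → ℂ)} (hx : IsEigen Ψ p x) (hy : IsEigen Ψ q y) :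
    IsEigen Ψ (p + q) (x * y) := fun γ lam => by
  rw [map_mul, hx γ lam, hy γ lam, smul_mul_smul_comm, pow_add]

/-- Powers: the `k`-th power of a `(p, p)`-class is a `(pk, pk)`-class. -/
theorem IsEigen.pow {p : ℕ} {x : ExteriorAlgebra ℂ (X → ℂ)} (hx : IsEigen Ψ p x) (k : ℕ) :
    IsEigen Ψ (p * k) (x ^ k) := by
  induction k with
  | zero => rw [pow_zero, Nat.mul_zero]; exact IsEigen.one
  | succ k ih => rw [pow_succ, Nat.mul_succ]; exact ih.mul hx

/-- Finite sums of `(p, p)`-classes. -/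
theorem IsEigen.sum {ι : Type*} (s : Finset ι) {p : ℕ} {f : ι → ExteriorAlgebra ℂ (X → ℂ)}
    (hf : ∀ i ∈ s, IsEigen Ψ p (f i)) : IsEigen Ψ p (∑ i ∈ s, f i) := by
  classical
  induction s using Finset.induction_on with
  | empty => rw [sum_empty]; exact IsEigen.zero p
  | insert i s hi ih =>
    rw [sum_insert hi]
    exact (hf i (mem_insert_self i s)).add (ih fun j hj => hf j (mem_insert_of_mem hj))

end Eigen

/-! ### The bridge to typer-2's `jointEigenspaceOn` -/

section Bridge

variable {R : Type*} [CommRing R] {M N : Type*} [AddCommGroup M] [Module R M] [AddCommGroup N] [Module R N]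

/-- `exteriorPower.map d f` is `ExteriorAlgebra.map f` on the underlying elements. -/
theorem coe_exteriorPower_map (f : M →ₗ[R] N) {d : ℕ} (x : ⋀[R]^d M) :
    ((exteriorPower.map d f x : ⋀[R]^d N) : ExteriorAlgebra R N) = ExteriorAlgebra.map f x := by
  have h : (⋀[R]^d N).subtype ∘ₗ exteriorPower.map d f =
      (ExteriorAlgebra.map f).toLinearMap ∘ₗ (⋀[R]^d M).subtype := by
    apply exteriorPower.alternatingMapLinearEquiv.symm.injective
    ext v
    simp only [exteriorPower.alternatingMapLinearEquiv_symm_apply, LinearMap.compAlternatingMap_apply,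
      LinearMap.comp_apply, Submodule.subtype_apply, exteriorPower.map_apply_ιMulti, exteriorPower.ιMulti_apply_coe,
      AlgHom.toLinearMap_apply, ExteriorAlgebra.map_apply_ιMulti]
  exact LinearMap.congr_fun h x

variable {X : Type*} [DecidableEq X] {Γ : Type*}

/-- A `(p, p)`-class of degree `d` in the algebra sense lies in typer-2's `jointEigenspaceOn Ψ d p`. -/
theorem mem_jointEigenspaceOn_of_isEigen (Ψ : Γ → Finset X) {d p : ℕ} (x : ⋀[ℂ]^d (X → ℂ))
    (hx : IsEigen Ψ p (x : ExteriorAlgebra ℂ (X → ℂ))) : x ∈ jointEigenspaceOn Ψ d p := by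
  rw [mem_jointEigenspaceOn_iff]
  intro γ lam
  apply Subtype.ext
  rw [coe_exteriorPower_map, hx γ lam, Submodule.coe_smul]

end Bridge

/-! ### The monomials, the `(1,1)`-classes and Weil's class -/

section Classes

variable {G : Type*} [Group G] [Fintype G] [DecidableEq G] [LinearOrder G]

omit [Group G] [Fintype G] [LinearOrder G] in
/-- The cocharacter multiplies a coordinate vector by `λ` or `1`, in the exterior algebra. -/
theorem map_cocharOn_ι {n : ℕ} (Φ : Finset (Fin n × G)) (lam : ℂ) (x : Fin n × G) :
    ExteriorAlgebra.map (cocharOn Φ lam) (ι ℂ (coordVecOn x : V G n)) =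
      (if x ∈ Φ then lam else 1) • ι ℂ (coordVecOn x : V G n) := by
  rw [ExteriorAlgebra.map_apply_ι, cocharOn_coordVecOn, map_smul]

omit [LinearOrder G] in
/-- **Every monomial `e_{(i,ρ)} ∧ e_{(i,cρ)}` is of type `(1, 1)`** for the Galois-conjugate product types of a
family `T` of CM types (exactly one of `ρ, cρ` lies in the CM type `g • T i`). -/
theorem isEigen_ωc {c : G} (hc : IsComplexConj c) {n : ℕ} (T : Fin n → Finset G) (hT : ∀ i, IsCMType c (T i))
    (p : Fin n × G) : IsEigen (fun g : G => prodTypeSet fun i => g • T i) 1 (ωc c n p) := by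
  intro g lam
  rw [ωc_apply, map_mul, map_cocharOn_ι, map_cocharOn_ι, smul_mul_smul_comm, pow_one]
  simp only [mem_prodTypeSet]
  have h := (hT p.1).smul hc g p.2
  by_cases hp : p.2 ∈ g • T p.1
  · rw [if_pos hp, if_neg (h.mp hp), mul_one]
  · rw [if_neg hp, if_pos (not_not.mp fun h' => hp (h.mpr h')), one_mul]

omit [LinearOrder G] in
/-- **The `(1,1)`-class of a factor is a `(1, 1)`-class** (in the algebra sense). -/
theorem isEigen_Lclass {c : G} (hc : IsComplexConj c) {Φ₀ : Finset G} {n : ℕ} (T : Fin n → Finset G)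
    (hT : ∀ i, IsCMType c (T i)) (a : Fin n → G → ℂ) (i : Fin n) :
    IsEigen (fun g : G => prodTypeSet fun i => g • T i) 1 (Lclass c Φ₀ a i : ExteriorAlgebra ℂ (V G n)) := by
  rw [Lclass, AddSubmonoidClass.coe_finsetSum]
  refine IsEigen.sum _ fun ρ _ => ?_
  rw [Subalgebra.coe_smul, ExtTop.coe_ω']
  exact (isEigen_ωc hc T hT (i, ρ)).smul _

omit [LinearOrder G] in
/-- **Weil's class is a `((m−1)n, (m−1)n)`-class** (in the algebra sense). -/
theorem isEigen_Λc {c : G} (hc : IsComplexConj c) {Φ₀ : Finset G} {n : ℕ} (T : Fin n → Finset G)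
    (hT : ∀ i, IsCMType c (T i)) (a : Fin n → G → ℂ) :
    IsEigen (fun g : G => prodTypeSet fun i => g • T i) ((Φ₀.card - 1) * n)
      (Λc c Φ₀ a : ExteriorAlgebra ℂ (V G n)) := by
  rw [Λc]
  have key : ∀ s : Finset (Fin n), IsEigen (fun g : G => prodTypeSet fun i => g • T i) ((Φ₀.card - 1) * s.card)
      ((∏ i ∈ s, Lclass c Φ₀ a i ^ (Φ₀.card - 1) : Ac c n) : ExteriorAlgebra ℂ (V G n)) := by
    intro s
    induction s using Finset.induction_on with
    | empty => rw [prod_empty, Subalgebra.coe_one, card_empty, Nat.mul_zero]; exact IsEigen.one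
    | insert i s hi ih =>
      rw [prod_insert hi, Subalgebra.coe_mul, Subalgebra.coe_pow, card_insert_of_notMem hi, Nat.mul_succ,
        Nat.add_comm]
      have h1 := (isEigen_Lclass (Φ₀ := Φ₀) hc T hT a i).pow (Φ₀.card - 1)
      rw [one_mul] at h1
      exact h1.mul ih
  have h := key univ
  rwa [card_univ, Fintype.card_fin] at h

omit [LinearOrder G] in
/-- **The `(1,1)`-classes of the factors are `(1, 1)`-classes** for every Galois-conjugate cocharacter of the
corner product `∏_i A_{T_i}`: `Lclass a i ∈ jointEigenspaceOn Ψ 2 1`. -/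
theorem Lclass_mem_jointEigenspaceOn {c : G} (hc : IsComplexConj c) {Φ₀ : Finset G} {n : ℕ}
    (T : Fin n → Finset G) (hT : ∀ i, IsCMType c (T i)) (a : Fin n → G → ℂ) (i : Fin n) :
    (⟨Lclass c Φ₀ a i, coe_Lclass_mem c Φ₀ a i⟩ : ⋀[ℂ]^2 (V G n)) ∈
      jointEigenspaceOn (fun g : G => prodTypeSet fun i => g • T i) 2 1 :=
  mem_jointEigenspaceOn_of_isEigen _ _ (isEigen_Lclass hc T hT a i)

omit [LinearOrder G] in
/-- **Weil's class `Λ = ∏_i L_i^{m−1}` is a Hodge class of type `((m−1)n, (m−1)n)`** for every Galois-conjugate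
cocharacter of the corner product `∏_i A_{T_i}`: `Λ ∈ jointEigenspaceOn Ψ (2(m−1)n) ((m−1)n)`. -/
theorem Λc_mem_jointEigenspaceOn {c : G} (hc : IsComplexConj c) {Φ₀ : Finset G} {n : ℕ}
    (T : Fin n → Finset G) (hT : ∀ i, IsCMType c (T i)) (a : Fin n → G → ℂ) :
    (⟨Λc c Φ₀ a, coe_Λc_mem c Φ₀ a⟩ : ⋀[ℂ]^(2 * (Φ₀.card - 1) * n) (V G n)) ∈
      jointEigenspaceOn (fun g : G => prodTypeSet fun i => g • T i) (2 * (Φ₀.card - 1) * n) ((Φ₀.card - 1) * n) :=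
  mem_jointEigenspaceOn_of_isEigen _ _ (isEigen_Λc hc T hT a)

end Classes

end HodgeRepro.Night3.GSetModel
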